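import Summits.PneNP.PneNP.Theorems.ReslinSizeFromWidthPCDegreeFPHPProved
import Summits.PneNP.PneNP.Theorems.ReslinSizeFromWidthPCDegreeConsequences
import Literature.Computability.MetaComplexity.OntoPigeonholeDegree
import Literature.Computability.MetaComplexity.RandomCNFPolynomialCalculusDegree
import HarnessLib

/-!
# PneNP / ReslinSizeFromWidth — the PC rail for PHP_G and FPHP_G over RANDOM bipartite graphs (unconditional, whp)

Helper file for the INPUT side of crux `ResLinSizeFromWidth` (stmt-PneNP-18932).  The tree proves
Alekhnovich–Razborov's degree lower bound for the graph pigeonhole principle `PHP_G` over a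
bipartite `(s, δ)`-boundary expander (`FPHP.not_refutableInDegree_phpCNF`, `OntoPigeonholeDegree.lean`)
and Mikša–Nordström's Thm 4.9 for the functional version `FPHP_G` with left degrees `≤ d`
(`MiksaNordstrom2015_PC_FPHP_degree_holds`; rail corollaries in
`ReslinSizeFromWidthPCDegreeFPHPProved.lean`) — both quantified over a bipartite boundary expander
that the tree does not construct ("it was established already in [AR03] that good bipartite
boundary expanders G yield formulas PHP_G that require large PC degree", Mikša–Nordström 2015,
§4.2; existence "by standard calculations").  This file supplies a RANDOM such family with
everything proved: the left-`k`-regular bipartite graph of a random `k`-CNF,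

* `scopeGraph n φ : Fin φ.length → Finset (Fin n)` — pigeon `i` (a clause position) may go to
  the holes (variables below `n`) of its clause; for `φ ∼ F_k(n, Δn)` (`randomKCNF k n (Δ * n)`)
  this is `Δn` pigeons each choosing a uniformly random `k`-set of `n` holes, independently;
* `holeScope_scopeGraph` — on the support its hole scopes are the clause scopes `cnfScopes φ`, so
  the tree's expansion count `randomKCNF_coverExpander_ge` (`RandomCNFPolynomialCalculusDegree.lean`:
  `(⌊κn⌋, (2k+1)/4)`-cover expansion except with probability `≤ 32aB⁴/n`) makes it a
  `(⌊κn⌋, 1/2)`-boundary expander w.h.p. (`randomKCNF_scopeGraph_boundaryExpander_ge`);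
* **`randomGraph_phpCNF_pcDegree_linear`** — for `k ≥ 3`, `Δ ≥ 1` there is `δ > 0` such that for
  every field `K`: `Pr[PHP over scopeGraph n φ has no PC/K refutation of degree ≤ δn] → 1`
  (Alekhnovich–Razborov's `PHP_G` bound on random left-regular graphs; `Δ ≥ 2` makes it a
  contradiction, more pigeons than holes);
* **`randomGraph_fphpCNF_pcDegree_linear`** — the same for MN15's FUNCTIONAL `FPHP_G` with rate
  `δ/k` (fields in `Type`, the universe of the discharged named fact);
* **`randomGraph_fphpCNF_resLin_rail`** — the rail for `FPHP_G` over the random graph, w.h.p.: for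
  every `k + 1 ≤ D ≤ (δ/k)·n`, every Res(⊕) refutation has a line of rank `≥ D`, tree-like ones
  have `≥ 2^(D-k-1)` lines, `2 + (D-1)D ≤ 2|π| + k(k+1)`, clause space `≥ D + 1 - k`.

Honest framing: corollaries by composition (expansion count + cover⇒boundary + the proved
AR/MN15 theorems + the rail); crude constants; the random graph is presented through the random
CNF's scopes (signs are irrelevant and simply forgotten).  Not claimed: the papers' density
dependence, PCR size, onto versions.

References: M. Alekhnovich, A. Razborov, FOCS 2001 / Proc. Steklov Inst. 242 (2003); M. Mikša,
J. Nordström, CCC 2015, §4.2, Thms 4.5, 4.9 (arXiv:1505.01358 pp. 19–23); E. Ben-Sasson,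
A. Wigderson, J. ACM 48 (2001) §6; K. Efremenko, M. Garlík, D. Itsykson, STOC 2024 §1.1.1.
-/

noncomputable section

namespace Summit.PneNP.PneNP.Theorems

-- `Summit.PneNP.PneNP` repeats a path component by design (summit = sub-problem); silence the linter.
set_option linter.dupNamespace false

namespace ResLinPC

open Finset Filter Literature.Computability.Complexity Literature.Computability.MetaComplexity
open Summit.PneNP.PneNP.Theorems.PolyCalc
open scoped Topology ENNReal

universe u

/-! ### The bipartite graph of a CNF -/

/-- The left-regular bipartite graph of a CNF over `n` holes: pigeon `i` (a clause position) is
adjacent to the holes `v < n` whose variable occurs in the `i`-th clause. [this file] -/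
def scopeGraph (n : ℕ) (φ : CNF ℕ) : Fin φ.length → Finset (Fin n) :=
  fun i => univ.filter fun v : Fin n => (v : ℕ) ∈ cnfScopes φ i

/-- For a CNF of `k`-clauses over `n` variables the hole scopes of `scopeGraph n φ` are the
clause scopes. [this file] -/
theorem holeScope_scopeGraph {k n : ℕ} {φ : CNF ℕ} (hφ : ∀ C ∈ φ, C ∈ kClauses k n) :
    FPHP.holeScope (scopeGraph n φ) = cnfScopes φ := by
  funext i
  ext x
  simp only [FPHP.holeScope, scopeGraph, Finset.mem_map, Finset.mem_filter, Finset.mem_univ,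
    true_and, Fin.valEmbedding_apply]
  constructor
  · rintro ⟨v, hv, rfl⟩
    exact hv
  · intro hx
    have hlt : x < n := by
      simpa using clauseScope_subset_range (hφ _ (List.getElem_mem _)) hx
    exact ⟨⟨x, hlt⟩, hx, rfl⟩

/-- Left degrees of `scopeGraph n φ` are `≤ k` for a CNF of `k`-clauses. [this file] -/
theorem card_scopeGraph_le {k n : ℕ} {φ : CNF ℕ} (hφ : ∀ C ∈ φ, C ∈ kClauses k n)
    (i : Fin φ.length) : (scopeGraph n φ i).card ≤ k := by
  rw [← FPHP.card_holeScope, holeScope_scopeGraph hφ]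
  exact (card_clauseScope_le _).trans (length_of_mem_kClauses (hφ _ (List.getElem_mem _))).le

/-- **Deterministic core**: if every clause of `φ` is a `k`-clause over `n` variables and the
clause scopes form an `(N, (2k+1)/4)`-cover expander, then `scopeGraph n φ` is an
`(N, 1/2)`-boundary expander (cover `(k + 1/2)/2` ⇒ boundary `1/2`). [Ben-Sasson–Wigderson 2001,
§6 (cover ⇒ boundary)] -/
theorem isBoundaryExpander_scopeGraph {k n N : ℕ} {φ : CNF ℕ} (hφ : ∀ C ∈ φ, C ∈ kClauses k n)
    (hcov : IsCoverExpander (cnfScopes φ) N ((2 * (k : ℝ) + 1) / 4)) :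
    IsBoundaryExpander (FPHP.holeScope (scopeGraph n φ)) N (1 / 2) := by
  classical
  rw [holeScope_scopeGraph hφ]
  have hcard : ∀ i, (cnfScopes φ i).card ≤ k := fun i =>
    (card_clauseScope_le _).trans (length_of_mem_kClauses (hφ _ (List.getElem_mem _))).le
  have : (2 * (k : ℝ) + 1) / 4 = ((k : ℝ) + 1 / 2) / 2 := by ring
  rw [this] at hcov
  exact hcov.isBoundaryExpander hcard

/-! ### The random bipartite graph expands w.h.p. -/

/-- **Random left-`k`-regular bipartite graphs are boundary expanders** (explicit form): for
`3 ≤ k ≤ n`, `Δ ≥ 1`, `a = (2k+1)/4`, `B = e^{1+a}Δa` and a radius `N` with `aN ≤ n/(2B)^4`,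
`Pr_{φ ∼ F_k(n, Δn)}[scopeGraph n φ is an (N, 1/2)-boundary expander] ≥ 1 - 32aB⁴/n`.
[Ben-Sasson–Wigderson 2001, §6; Chvátal–Szemerédi 1988, Lemma 1 (the count, in the tree)] -/
theorem randomKCNF_scopeGraph_boundaryExpander_ge {k Δ n N : ℕ} {a B : ℝ} (hk : 3 ≤ k)
    (hΔ : 1 ≤ Δ) (hkn : k ≤ n) (ha : a = (2 * k + 1) / 4) (hB : B = Real.exp (1 + a) * Δ * a)
    (hN : a * N ≤ n / (2 * B) ^ 4) :
    1 - ENNReal.ofReal (32 * a * B ^ 4 / n) ≤ (randomKCNF k n (Δ * n)).toOuterMeasure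
      {φ | IsBoundaryExpander (FPHP.holeScope (scopeGraph n φ)) N (1 / 2)} := by
  refine (randomKCNF_coverExpander_ge hk hΔ hkn ha hB hN).trans (PMF.toOuterMeasure_mono _ ?_)
  rintro φ ⟨hcov, hsupp⟩
  have hall := forall_mem_of_mem_support_randomKCNF hsupp
  have hcov' : IsCoverExpander (cnfScopes φ) N ((2 * (k : ℝ) + 1) / 4) := by
    have : a = (2 * (k : ℝ) + 1) / 4 := by rw [ha]
    rw [← this]; exact hcov
  exact isBoundaryExpander_scopeGraph hall hcov'

/-! ### Bookkeeping -/

/-- If `μ n ≤ 1`, `β n → 0` and eventually `1 - β n ≤ μ n`, then `μ n → 1`. [bookkeeping] -/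
private theorem tendsto_one_of_eventually_ge'' {μ : ℕ → ℝ≥0∞} {β : ℕ → ℝ} (hμ : ∀ n, μ n ≤ 1)
    (hβ : Tendsto β atTop (𝓝 0)) (h : ∀ᶠ n in atTop, 1 - ENNReal.ofReal (β n) ≤ μ n) :
    Tendsto μ atTop (𝓝 1) := by
  have hβE : Tendsto (fun n => ENNReal.ofReal (β n)) atTop (𝓝 0) := by
    have := ENNReal.tendsto_ofReal hβ
    rwa [ENNReal.ofReal_zero] at this
  have hlow : Tendsto (fun n => 1 - ENNReal.ofReal (β n)) atTop (𝓝 1) := by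
    have := ENNReal.Tendsto.sub (tendsto_const_nhds (x := (1 : ℝ≥0∞))) hβE
      (Or.inl ENNReal.one_ne_top)
    rwa [tsub_zero] at this
  exact tendsto_of_tendsto_of_tendsto_of_le_of_le' hlow tendsto_const_nhds h
    (Eventually.of_forall fun n => hμ n)

/-- An event of a `PMF` has probability at most one. [bookkeeping] -/
private theorem pmf_toOuterMeasure_le_one'' {α : Type*} (p : PMF α) (E : Set α) :
    p.toOuterMeasure E ≤ 1 :=
  (MeasureTheory.measure_mono (Set.subset_univ _)).trans_eq
    ((PMF.toOuterMeasure_apply_eq_one_iff _ _).2 (Set.subset_univ _))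

/-- The constants of the expansion count: with `a = (2k+1)/4`, `B = e^{1+a}Δa`,
`κ = 1/(a(2B)^4)`, for `n ≥ (k+5)/κ` the radius `N = ⌊κn⌋` satisfies `2 ≤ N`, `k ≤ n`,
`aN ≤ n/(2B)^4` and `κn - 1 < N`. [bookkeeping] -/
private theorem radius_bookkeeping {k Δ n : ℕ} (hk : 3 ≤ k) (hΔ : 1 ≤ Δ) {a B κ : ℝ}
    (ha : a = (2 * k + 1) / 4) (hB : B = Real.exp (1 + a) * Δ * a) (hκ : κ = 1 / (a * (2 * B) ^ 4))
    (hn : ⌈((k : ℝ) + 5) / κ⌉₊ ≤ n) :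
    0 < κ ∧ 2 ≤ ⌊κ * n⌋₊ ∧ k ≤ n ∧ a * (⌊κ * n⌋₊ : ℕ) ≤ n / (2 * B) ^ 4 ∧
      κ * n - 1 < (⌊κ * n⌋₊ : ℕ) ∧ ((k : ℝ) + 5) ≤ κ * n := by
  have hk3 : (3 : ℝ) ≤ k := by exact_mod_cast hk
  have hΔ1 : (1 : ℝ) ≤ Δ := by exact_mod_cast hΔ
  have ha74 : (7 : ℝ) / 4 ≤ a := by rw [ha]; linarith
  have hapos : 0 < a := by linarith
  have hBpos : 0 < B := by rw [hB]; positivity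
  have hκpos : 0 < κ := by rw [hκ]; positivity
  have hκn : ((k : ℝ) + 5) ≤ κ * n := by
    have h1 : ((k : ℝ) + 5) / κ ≤ n := (Nat.le_ceil _).trans (by exact_mod_cast hn)
    rw [div_le_iff₀ hκpos] at h1
    linarith
  have hNle : ((⌊κ * n⌋₊ : ℕ) : ℝ) ≤ κ * n := Nat.floor_le (by positivity)
  have hNge : κ * n - 1 < ((⌊κ * n⌋₊ : ℕ) : ℝ) := Nat.sub_one_lt_floor _
  have hk0 : (0 : ℝ) ≤ k := Nat.cast_nonneg k
  have hN2 : 2 ≤ ⌊κ * n⌋₊ := by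
    have : (2 : ℝ) < ((⌊κ * n⌋₊ : ℕ) : ℝ) := by linarith
    exact_mod_cast this.le
  have hkn : k ≤ n := by
    have hκ1 : κ ≤ 1 := by
      rw [hκ, div_le_one (by positivity)]
      have h2B : (1 : ℝ) ≤ 2 * B := by
        rw [hB]
        have h1 : (1 : ℝ) ≤ Real.exp (1 + a) := Real.one_le_exp (by linarith)
        nlinarith [mul_le_mul h1 hΔ1 (by norm_num) (by linarith : (0 : ℝ) ≤ Real.exp (1 + a))]
      have h2B4 : (1 : ℝ) ≤ (2 * B) ^ 4 := one_le_pow₀ h2B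
      nlinarith
    have : (k : ℝ) ≤ n := by
      nlinarith [mul_nonneg (sub_nonneg.2 hκ1) (Nat.cast_nonneg (α := ℝ) n)]
    exact_mod_cast this
  have haN : a * ((⌊κ * n⌋₊ : ℕ) : ℝ) ≤ n / (2 * B) ^ 4 := by
    calc a * ((⌊κ * n⌋₊ : ℕ) : ℝ) ≤ a * (κ * n) := mul_le_mul_of_nonneg_left hNle hapos.le
      _ = n / (2 * B) ^ 4 := by rw [hκ]; field_simp
  exact ⟨hκpos, hN2, hkn, haN, hNge, hκn⟩

/-! ### PHP_G over the random graph: linear PC degree, every field -/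

/-- **Alekhnovich–Razborov's `PHP_G` bound on random left-regular bipartite graphs**: for `k ≥ 3`
and `Δ ≥ 1` there is `δ = δ(k,Δ) > 0` such that for every field `K`,
`Pr_{φ ∼ F_k(n, Δn)}[PHP over scopeGraph n φ has no PC/K refutation of degree ≤ δn] → 1`.
(`δ = κ/5`.) [Alekhnovich–Razborov 2001 (PHP_G over boundary expanders, via Mikša–Nordström 2015
Thm 4.5 / §4.2 — proved in the tree); Ben-Sasson–Wigderson 2001 §6 (expansion)] -/
theorem randomGraph_phpCNF_pcDegree_linear (k Δ : ℕ) (hk : 3 ≤ k) (hΔ : 1 ≤ Δ) :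
    ∃ δ : ℝ, 0 < δ ∧ ∀ (K : Type u) [Field K],
      Tendsto (fun n : ℕ => (randomKCNF k n (Δ * n)).toOuterMeasure
        {φ | ∀ D : ℕ, (D : ℝ) ≤ δ * n →
          ¬ PC.RefutableInDegree (PC.ofCNF K (FPHP.phpCNF (scopeGraph n φ))) D})
        atTop (𝓝 1) := by
  set a : ℝ := (2 * k + 1) / 4 with ha
  set B : ℝ := Real.exp (1 + a) * Δ * a with hB
  set κ : ℝ := 1 / (a * (2 * B) ^ 4) with hκ
  have hapos : 0 < a := by
    have hk3 : (3 : ℝ) ≤ k := by exact_mod_cast hk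
    rw [ha]; linarith
  have hBpos : 0 < B := by rw [hB]; positivity
  have hκpos : 0 < κ := by rw [hκ]; positivity
  refine ⟨κ / 5, by positivity, fun K _ => ?_⟩
  refine tendsto_one_of_eventually_ge'' (β := fun n => 32 * a * B ^ 4 / n)
    (fun n => pmf_toOuterMeasure_le_one'' _ _)
    (by simpa using tendsto_const_div_atTop_nhds_zero_nat (32 * a * B ^ 4)) ?_
  refine eventually_atTop.2 ⟨⌈((k : ℝ) + 5) / κ⌉₊, fun n hn => ?_⟩
  obtain ⟨-, hN2, hkn, haN, hNge, hκn⟩ := radius_bookkeeping hk hΔ ha hB hκ hn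
  refine (randomKCNF_scopeGraph_boundaryExpander_ge hk hΔ hkn ha hB haN).trans
    (MeasureTheory.measure_mono fun φ hφ D hD => ?_)
  refine FPHP.not_refutableInDegree_phpCNF (by exact_mod_cast hN2) (by norm_num) hφ ?_
  have : κ / 5 * n ≤ (κ * n - 1) / 4 := by linarith
  linarith

/-! ### FPHP_G over the random graph: linear PC degree and the rail -/

/-- **Mikša–Nordström's `FPHP_G` bound on random left-regular bipartite graphs**: for `k ≥ 3`
and `Δ ≥ 1` there is `δ = δ(k,Δ) > 0` such that for every field `K` (in `Type`),
`Pr_{φ ∼ F_k(n, Δn)}[FPHP over scopeGraph n φ has no PC/K refutation of degree ≤ δn] → 1`.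
(`δ = κ/(5k)`: MN15's bound `δs/(2d)` with left degree `d = k`.) [Mikša–Nordström 2015, Thm 4.9
— proved in the tree; Ben-Sasson–Wigderson 2001 §6 (expansion)] -/
theorem randomGraph_fphpCNF_pcDegree_linear (k Δ : ℕ) (hk : 3 ≤ k) (hΔ : 1 ≤ Δ) :
    ∃ δ : ℝ, 0 < δ ∧ ∀ (K : Type) [Field K],
      Tendsto (fun n : ℕ => (randomKCNF k n (Δ * n)).toOuterMeasure
        {φ | ∀ D : ℕ, (D : ℝ) ≤ δ * n →
          ¬ PC.RefutableInDegree (PC.ofCNF K (FPHP.fphpCNF (scopeGraph n φ))) D})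
        atTop (𝓝 1) := by
  set a : ℝ := (2 * k + 1) / 4 with ha
  set B : ℝ := Real.exp (1 + a) * Δ * a with hB
  set κ : ℝ := 1 / (a * (2 * B) ^ 4) with hκ
  have hk3 : (3 : ℝ) ≤ k := by exact_mod_cast hk
  have hkpos : (0 : ℝ) < k := by linarith
  have hapos : 0 < a := by rw [ha]; linarith
  have hBpos : 0 < B := by rw [hB]; positivity
  have hκpos : 0 < κ := by rw [hκ]; positivity
  refine ⟨κ / (5 * k), by positivity, fun K _ => ?_⟩
  refine tendsto_one_of_eventually_ge'' (β := fun n => 32 * a * B ^ 4 / n)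
    (fun n => pmf_toOuterMeasure_le_one'' _ _)
    (by simpa using tendsto_const_div_atTop_nhds_zero_nat (32 * a * B ^ 4)) ?_
  refine eventually_atTop.2 ⟨⌈((k : ℝ) + 5) / κ⌉₊, fun n hn => ?_⟩
  obtain ⟨-, hN2, hkn, haN, hNge, hκn⟩ := radius_bookkeeping hk hΔ ha hB hκ hn
  refine (randomKCNF_scopeGraph_boundaryExpander_ge hk hΔ hkn ha hB haN).trans
    (PMF.toOuterMeasure_mono _ ?_)
  rintro φ ⟨hφ, hsupp⟩ D hD
  have hall := forall_mem_of_mem_support_randomKCNF hsupp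
  have hN1 : (1 : ℝ) ≤ (⌊κ * n⌋₊ : ℕ) := by exact_mod_cast (show 1 ≤ ⌊κ * n⌋₊ by omega)
  refine MiksaNordstrom2015_PC_FPHP_degree_holds K _ n (scopeGraph n φ) _ (1 / 2) k hN1
    (by norm_num) (by omega) (card_scopeGraph_le hall) hφ D ?_
  -- `D ≤ κ n/(5k) ≤ (κ n - 1)/(4k) ≤ (1/2) N / (2k)`
  rw [le_div_iff₀ (by positivity)]
  have h1 : (D : ℝ) * (2 * k) ≤ κ / (5 * k) * n * (2 * k) :=
    mul_le_mul_of_nonneg_right hD (by positivity)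
  have h2 : κ / (5 * k) * n * (2 * k) = 2 * (κ / 5 * n) := by field_simp
  have h3 : κ / 5 * n ≤ (κ * n - 1) / 4 := by linarith
  nlinarith

/-- **The FPHP_G rail over the random graph**: for `k ≥ 3`, `Δ ≥ 1` there is `δ > 0` such
that with probability `→ 1` over `φ ∼ F_k(n, Δn)`, for every `D` with `k + 1 ≤ D ≤ δn`: every
Res(⊕) refutation (semantic weakening) of `FPHP` over `scopeGraph n φ` has a line of rank `≥ D`,
every tree-like one has `≥ 2^(D-k-1)` lines, `2 + (D-1)D ≤ 2|π| + k(k+1)`, and every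
configuration-style one has clause space `≥ D + 1 - k`. [Mikša–Nordström 2015, Thm 4.9;
Efremenko–Garlík–Itsykson 2024, §1.1.1 (FPHP example); Gryaznov–Ovcharov–Riazanov 2024, Thm 11
(shape); the tree's rail] -/
theorem randomGraph_fphpCNF_resLin_rail (k Δ : ℕ) (hk : 3 ≤ k) (hΔ : 1 ≤ Δ) :
    ∃ δ : ℝ, 0 < δ ∧ Tendsto (fun n : ℕ => (randomKCNF k n (Δ * n)).toOuterMeasure
      {φ | ∀ D : ℕ, k + 1 ≤ D → (D : ℝ) ≤ δ * n →
        (∀ π : List ResLinLine, IsResLinRefutation (FPHP.fphpCNF (scopeGraph n φ)) π →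
          D ≤ resLinWidth π ∧
          ((∀ i : ℕ, (π.map fun l => l.premises.count i).sum ≤ 1) → 2 ^ (D - k - 1) ≤ π.length) ∧
          2 + (D - 1) * D ≤ 2 * π.length + k * (k + 1)) ∧
        ∀ ϖ : List (Finset LinClause), IsResLinSpaceRefutation (FPHP.fphpCNF (scopeGraph n φ)) ϖ →
          D + 1 - k ≤ resLinClauseSpace ϖ}) atTop (𝓝 1) := by
  set a : ℝ := (2 * k + 1) / 4 with ha
  set B : ℝ := Real.exp (1 + a) * Δ * a with hB
  set κ : ℝ := 1 / (a * (2 * B) ^ 4) with hκ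
  have hk3 : (3 : ℝ) ≤ k := by exact_mod_cast hk
  have hkpos : (0 : ℝ) < k := by linarith
  have hapos : 0 < a := by rw [ha]; linarith
  have hBpos : 0 < B := by rw [hB]; positivity
  have hκpos : 0 < κ := by rw [hκ]; positivity
  refine ⟨κ / (5 * k), by positivity, ?_⟩
  refine tendsto_one_of_eventually_ge'' (β := fun n => 32 * a * B ^ 4 / n)
    (fun n => pmf_toOuterMeasure_le_one'' _ _)
    (by simpa using tendsto_const_div_atTop_nhds_zero_nat (32 * a * B ^ 4)) ?_
  refine eventually_atTop.2 ⟨⌈((k : ℝ) + 5) / κ⌉₊, fun n hn => ?_⟩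
  obtain ⟨-, hN2, hkn, haN, hNge, hκn⟩ := radius_bookkeeping hk hΔ ha hB hκ hn
  refine (randomKCNF_scopeGraph_boundaryExpander_ge hk hΔ hkn ha hB haN).trans
    (PMF.toOuterMeasure_mono _ ?_)
  rintro φ ⟨hφ, hsupp⟩ D hkD hD
  have hall := forall_mem_of_mem_support_randomKCNF hsupp
  have hN1 : (1 : ℝ) ≤ (⌊κ * n⌋₊ : ℕ) := by exact_mod_cast (show 1 ≤ ⌊κ * n⌋₊ by omega)
  have hdeg := card_scopeGraph_le (n := n) hall
  have hk1 : 1 ≤ k := by omega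
  have hmax : max k 2 = k := max_eq_left (by omega)
  have hD' : (D : ℝ) ≤ 1 / 2 * (⌊κ * n⌋₊ : ℕ) / (2 * k) := by
    rw [le_div_iff₀ (by positivity)]
    have h1 : (D : ℝ) * (2 * k) ≤ κ / (5 * k) * n * (2 * k) :=
      mul_le_mul_of_nonneg_right hD (by positivity)
    have h2 : κ / (5 * k) * n * (2 * k) = 2 * (κ / 5 * n) := by field_simp
    have h3 : κ / 5 * n ≤ (κ * n - 1) / 4 := by linarith
    nlinarith
  have hδ : (0 : ℝ) < 1 / 2 := by norm_num
  refine ⟨fun π hπ => ⟨?_, fun htree => ?_, ?_⟩, fun ϖ hϖ => ?_⟩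
  · exact resLinWidth_fphpCNF' (scopeGraph n φ) hN1 hδ hk1 hdeg hφ (by rw [hmax]; omega) hD' hπ
  · have h := treeLike_length_fphpCNF' (scopeGraph n φ) hN1 hδ hk1 hdeg hφ (by rw [hmax]; omega)
      hD' hπ htree
    rwa [hmax] at h
  · have h := quadratic_length_fphpCNF' (scopeGraph n φ) hN1 hδ hk1 hdeg hφ (by rw [hmax]; omega)
      hD' hπ
    rwa [hmax] at h
  · have h := clauseSpace_fphpCNF' (scopeGraph n φ) hN1 hδ hk1 hdeg hφ (by rw [hmax]; omega) hD' hϖ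
    rwa [hmax] at h

end ResLinPC

end Summit.PneNP.PneNP.Theorems
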